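import Summits.CriticalPhenomena.PercolationContinuityZ3.Theorems.PercNearOneGluingNoHeavyConstsChainRuleBetweenWorld
import Summits.CriticalPhenomena.PercolationContinuityZ3.Theorems.PercNearOneGluingNoHeavyConstsSingleEdgeDisconnection
import Mathlib.LinearAlgebra.Matrix.Determinant.Basic
import HarnessLib
import HarnessLib.Audit.Tags

/-!
# The single-edge chain rule: the genuine / between-world split (IDENTITY) and the chain rule in the marker-dominance regime (COROLLARY)
# (PAPER-2 track (ii): constants of the CSH family)

builds on p205010 (kernel theorem, internal audit signed; external expert review pending).  Support file (`--supports
stmt-CriticalPhenomena-4575`), seat `prim-consts-2` (gen 7); rows A6/A11 of `run/shared/lean/prim/consts/CONSTANTS.md`; memo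
`run/shared/lean/prim/consts/FROM-prim-consts-2-g7-ROW-SPLIT.md` §3, §8.  No definitions, no named facts, no sorries; standard axioms.

Notation `K(S,T) = μ{S ↮ T}`, `R₁ = K(x,Y)`, `R₂ = K(xu,Y)`, `R₃ = K(xuv,Y)`, `N_i = K(S_i, Y∪v)`, `O_i = μ{S_i ↮ Y, o ∈ C_{S_i}} = R_i − K(S_i,Y∪o)`,
`Δ` = the chain-rule minor of `Consts.SingleEdgeChainRule` (OPEN).  With the GENUINE gains `G_o = μ{xu ↮ Y, o ∈ C_u ∖ C_x}`,
`G_v = μ{xu ↮ Y, v ∈ C_u ∖ C_x}` and the BETWEEN-WORLD boosts `E_t = R₁·μ{xu ↮ Y, x ↔ t} − R₂·μ{x ↮ Y, x ↔ t}` (`= R₁R₂·ε_t` of the memo):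

* `Consts.chainRuleDet_mul_eq_genuine_betweenWorld` — **IDENTITY**  `R₂ · Δ = N₂ R₃ · (R₁ G_o + E_o) − (R₁ G_v + E_v) · (O₃ R₂ − O₂ R₃)`
  (the conditional form `t₂(a₂ − a₁) − (b₂ − b₁)(a₃ − a₂)` with `a₂ − a₁ = Q(o ∈ C_u∖C_x) + ε_o`, `b₂ − b₁ = Q(v ∈ C_u∖C_x) + ε_v`).
* `Consts.chainRuleDet_nonneg_of_betweenWorld_regime` — **COROLLARY: CR in the marker-dominance regime.**  With `𝒜 = {v ↮ {x}∪Y}`, `W = {v↔o}`: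
  if `μ(𝒜)·N₂R₃R₁·G_o + N₂R₃·μ(𝒜∩W)·E_v ≥ μ(𝒜)·(R₁G_v + E_v)·(O₃R₂ − O₂R₃)` — i.e. (dividing) the genuine inequality with the `o`-boost replaced
  by its MARKER-DOMINANCE lower bound `p·ε_v`, `p = P(o ∈ C_v | v ↮ xY)`: `t₂·[Q(o∈C_u∖C_x) + p·ε_v] ≥ [Q(v∈C_u∖C_x) + ε_v]·(a₃ − a₂)` — then
  `μ(𝒜)·R₂·Δ ≥ 0` (so `Δ ≥ 0` off the degenerate locus `μ(𝒜)R₂ = 0`), by `Consts.betweenWorld_markerDominance` (`μ(𝒜∩W)E_v ≤ μ(𝒜)E_o`).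
  Exact numerics of the seat (work/explore/test_regimes.py, 2 700 random weighted instances n ≤ 7): this regime covers ≈ 72 %, the regime
  `a₃ ≥ c₁` of `Consts.chainRuleDet_nonneg_of_level_three_ge` (p303954) ≈ 59 %, their union ≈ 83 %; CR holds in 100 %.
[cite: VandenbergHaggstromKahn2005, Thm. 1.3 (p. 6), Thm. 1.1 (pp. 3–5)] [cite: Gladkov2024, Thm. 3.2]
-/

noncomputable section

namespace Summit.CriticalPhenomena.PercolationContinuityZ3.Theorems

open MeasureTheory Set Literature.Probability.LatticeModels Literature.Probability.Percolation
open scoped Classical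

namespace Consts

/-- Notation (this file only): the disconnection kernel `𝕂[w](S, T) = μ_w{S ↮ T}`. -/
local notation3 "𝕂[" w "](" S ", " T ")" =>
  MeasureTheory.Measure.real (prodBernoulli w) {ω | ∀ s ∈ S, ∀ t ∈ T, ¬ (openGraph ω).Reachable s t}

variable {V : Type*} [Fintype V]

/-- **IDENTITY — genuine / between-world split of the chain-rule minor.**
`K(xu,Y) · Δ = N₂R₃·(R₁G_o + E_o) − (R₁G_v + E_v)·(O₃R₂ − O₂R₃)` in the notation of the file header (all quantities written out as measures).
[cite: VandenbergHaggstromKahn2005, Thm. 1.1 (pp. 3–5)] -/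
theorem chainRuleDet_mul_eq_genuine_betweenWorld (w : Sym2 V → unitInterval) (x u v o : V) (Y : Set V) :
    𝕂[w](({x, u} : Set V), Y) * Matrix.det !![
      𝕂[w](({x} : Set V), insert v Y), 𝕂[w](({x} : Set V), Y), 𝕂[w](({x} : Set V), insert o Y);
      𝕂[w](({x, u} : Set V), insert v Y), 𝕂[w](({x, u} : Set V), Y), 𝕂[w](({x, u} : Set V), insert o Y);
      𝕂[w](({x, u, v} : Set V), insert v Y), 𝕂[w](({x, u, v} : Set V), Y), 𝕂[w](({x, u, v} : Set V), insert o Y)] =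
    𝕂[w](({x, u} : Set V), insert v Y) * 𝕂[w](({x, u, v} : Set V), Y) *
        (𝕂[w](({x} : Set V), Y) *
            (prodBernoulli w).real ({ω : BondConfig V | ∀ y ∈ Y, ¬ (openGraph ω).Reachable x y ∧ ¬ (openGraph ω).Reachable u y} ∩
              openConn u o ∩ (openConn x o)ᶜ) +
          (𝕂[w](({x} : Set V), Y) *
              (prodBernoulli w).real ({ω : BondConfig V | ∀ y ∈ Y, ¬ (openGraph ω).Reachable x y ∧ ¬ (openGraph ω).Reachable u y} ∩
                openConn x o) -
            𝕂[w](({x, u} : Set V), Y) *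
              (prodBernoulli w).real ({ω : BondConfig V | ∀ y ∈ Y, ¬ (openGraph ω).Reachable x y} ∩ openConn x o))) -
      (𝕂[w](({x} : Set V), Y) *
            (prodBernoulli w).real ({ω : BondConfig V | ∀ y ∈ Y, ¬ (openGraph ω).Reachable x y ∧ ¬ (openGraph ω).Reachable u y} ∩
              openConn u v ∩ (openConn x v)ᶜ) +
          (𝕂[w](({x} : Set V), Y) *
              (prodBernoulli w).real ({ω : BondConfig V | ∀ y ∈ Y, ¬ (openGraph ω).Reachable x y ∧ ¬ (openGraph ω).Reachable u y} ∩
                openConn x v) -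
            𝕂[w](({x, u} : Set V), Y) *
              (prodBernoulli w).real ({ω : BondConfig V | ∀ y ∈ Y, ¬ (openGraph ω).Reachable x y} ∩ openConn x v))) *
        ((prodBernoulli w).real ({ω : BondConfig V | ∀ y ∈ Y, ¬ (openGraph ω).Reachable x y ∧ ¬ (openGraph ω).Reachable u y ∧
              ¬ (openGraph ω).Reachable v y} ∩ (openConn x o ∪ openConn u o ∪ openConn v o)) * 𝕂[w](({x, u} : Set V), Y) -
          (prodBernoulli w).real ({ω : BondConfig V | ∀ y ∈ Y, ¬ (openGraph ω).Reachable x y ∧ ¬ (openGraph ω).Reachable u y} ∩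
              (openConn x o ∪ openConn u o)) * 𝕂[w](({x, u, v} : Set V), Y)) := by
  classical
  set μ := prodBernoulli w with hμ
  have hmeas : ∀ T : Set (BondConfig V), MeasurableSet T := fun _ => MeasurableSet.of_discrete
  -- kernel entries
  set R1 := 𝕂[w](({x} : Set V), Y) with hR1
  set R2 := 𝕂[w](({x, u} : Set V), Y) with hR2
  set R3 := 𝕂[w](({x, u, v} : Set V), Y) with hR3
  set N1 := 𝕂[w](({x} : Set V), insert v Y) with hN1
  set N2 := 𝕂[w](({x, u} : Set V), insert v Y) with hN2
  set N3 := 𝕂[w](({x, u, v} : Set V), insert v Y) with hN3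
  set Q1 := 𝕂[w](({x} : Set V), insert o Y) with hQ1
  set Q2 := 𝕂[w](({x, u} : Set V), insert o Y) with hQ2
  set Q3 := 𝕂[w](({x, u, v} : Set V), insert o Y) with hQ3
  -- the row events
  set D1 : Set (BondConfig V) := {ω | ∀ y ∈ Y, ¬ (openGraph ω).Reachable x y} with hD1
  set D2 : Set (BondConfig V) := {ω | ∀ y ∈ Y, ¬ (openGraph ω).Reachable x y ∧ ¬ (openGraph ω).Reachable u y} with hD2
  set D3 : Set (BondConfig V) := {ω | ∀ y ∈ Y, ¬ (openGraph ω).Reachable x y ∧ ¬ (openGraph ω).Reachable u y ∧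
    ¬ (openGraph ω).Reachable v y} with hD3
  have hN30 : N3 = 0 := by
    have : {ω : BondConfig V | ∀ s ∈ ({x, u, v} : Set V), ∀ t ∈ insert v Y, ¬ (openGraph ω).Reachable s t} = ∅ := by
      ext ω
      simp only [mem_setOf_eq, mem_empty_iff_false, iff_false, not_forall, not_not]
      exact ⟨v, by simp, v, mem_insert _ _, SimpleGraph.Reachable.refl _⟩
    rw [hN3, this]; simp
  -- `D_i` as kernel sets
  have eD1 : {ω : BondConfig V | ∀ s ∈ ({x} : Set V), ∀ t ∈ Y, ¬ (openGraph ω).Reachable s t} = D1 := by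
    ext ω; simp [hD1]
  have eD2 : {ω : BondConfig V | ∀ s ∈ ({x, u} : Set V), ∀ t ∈ Y, ¬ (openGraph ω).Reachable s t} = D2 := by
    ext ω
    simp only [mem_setOf_eq, mem_insert_iff, mem_singleton_iff, forall_eq_or_imp, forall_eq, hD2]
    exact ⟨fun h t ht => ⟨h.1 t ht, h.2 t ht⟩, fun h => ⟨fun t ht => (h t ht).1, fun t ht => (h t ht).2⟩⟩
  have eD3 : {ω : BondConfig V | ∀ s ∈ ({x, u, v} : Set V), ∀ t ∈ Y, ¬ (openGraph ω).Reachable s t} = D3 := by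
    ext ω
    simp only [mem_setOf_eq, mem_insert_iff, mem_singleton_iff, forall_eq_or_imp, forall_eq, hD3]
    exact ⟨fun h t ht => ⟨h.1 t ht, h.2.1 t ht, h.2.2 t ht⟩,
      fun h => ⟨fun t ht => (h t ht).1, fun t ht => (h t ht).2.1, fun t ht => (h t ht).2.2⟩⟩
  -- `O_i = R_i − Q_i` (as `μ(D_i ∩ {o ∈ C_{S_i}}) = μ(D_i) − K(S_i, Y∪o)`)
  have hO1 : μ.real (D1 ∩ openConn x o) = R1 - Q1 := by
    have hsub : {ω : BondConfig V | ∀ s ∈ ({x} : Set V), ∀ t ∈ insert o Y, ¬ (openGraph ω).Reachable s t} ⊆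
        {ω : BondConfig V | ∀ s ∈ ({x} : Set V), ∀ t ∈ Y, ¬ (openGraph ω).Reachable s t} :=
      fun ω h s hs t ht => h s hs t (mem_insert_of_mem _ ht)
    have hdiff : {ω : BondConfig V | ∀ s ∈ ({x} : Set V), ∀ t ∈ Y, ¬ (openGraph ω).Reachable s t} \
        {ω : BondConfig V | ∀ s ∈ ({x} : Set V), ∀ t ∈ insert o Y, ¬ (openGraph ω).Reachable s t} = D1 ∩ openConn x o := by
      ext ω
      simp only [mem_sdiff, mem_setOf_eq, mem_singleton_iff, forall_eq, mem_insert_iff, forall_eq_or_imp, mem_inter_iff, hD1, openConn]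
      constructor
      · rintro ⟨h1, h2⟩; exact ⟨h1, by by_contra hxo; exact h2 ⟨hxo, h1⟩⟩
      · rintro ⟨h1, hxo⟩; exact ⟨h1, fun h => h.1 hxo⟩
    rw [← hdiff, measureReal_sdiff hsub (hmeas _), hR1, hQ1]
  have hO2 : μ.real (D2 ∩ (openConn x o ∪ openConn u o)) = R2 - Q2 := by
    have hsub : {ω : BondConfig V | ∀ s ∈ ({x, u} : Set V), ∀ t ∈ insert o Y, ¬ (openGraph ω).Reachable s t} ⊆
        {ω : BondConfig V | ∀ s ∈ ({x, u} : Set V), ∀ t ∈ Y, ¬ (openGraph ω).Reachable s t} :=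
      fun ω h s hs t ht => h s hs t (mem_insert_of_mem _ ht)
    have hdiff : {ω : BondConfig V | ∀ s ∈ ({x, u} : Set V), ∀ t ∈ Y, ¬ (openGraph ω).Reachable s t} \
        {ω : BondConfig V | ∀ s ∈ ({x, u} : Set V), ∀ t ∈ insert o Y, ¬ (openGraph ω).Reachable s t} =
        D2 ∩ (openConn x o ∪ openConn u o) := by
      rw [eD2]; ext ω
      simp only [mem_sdiff, mem_setOf_eq, mem_insert_iff, mem_singleton_iff, forall_eq_or_imp, forall_eq, mem_inter_iff, hD2,
        mem_union, openConn]
      constructor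
      · rintro ⟨h1, h2⟩
        refine ⟨h1, ?_⟩
        by_contra hno; rw [not_or] at hno
        exact h2 ⟨⟨hno.1, fun t ht => (h1 t ht).1⟩, ⟨hno.2, fun t ht => (h1 t ht).2⟩⟩
      · rintro ⟨h1, hor⟩
        refine ⟨h1, fun h => ?_⟩
        rcases hor with hxo | huo
        · exact h.1.1 hxo
        · exact h.2.1 huo
    rw [← hdiff, measureReal_sdiff hsub (hmeas _), hR2, hQ2]
  have hO3 : μ.real (D3 ∩ (openConn x o ∪ openConn u o ∪ openConn v o)) = R3 - Q3 := by
    have hsub : {ω : BondConfig V | ∀ s ∈ ({x, u, v} : Set V), ∀ t ∈ insert o Y, ¬ (openGraph ω).Reachable s t} ⊆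
        {ω : BondConfig V | ∀ s ∈ ({x, u, v} : Set V), ∀ t ∈ Y, ¬ (openGraph ω).Reachable s t} :=
      fun ω h s hs t ht => h s hs t (mem_insert_of_mem _ ht)
    have hdiff : {ω : BondConfig V | ∀ s ∈ ({x, u, v} : Set V), ∀ t ∈ Y, ¬ (openGraph ω).Reachable s t} \
        {ω : BondConfig V | ∀ s ∈ ({x, u, v} : Set V), ∀ t ∈ insert o Y, ¬ (openGraph ω).Reachable s t} =
        D3 ∩ (openConn x o ∪ openConn u o ∪ openConn v o) := by
      rw [eD3]; ext ω
      simp only [mem_sdiff, mem_setOf_eq, mem_insert_iff, mem_singleton_iff, forall_eq_or_imp, forall_eq, mem_inter_iff, hD3,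
        mem_union, openConn]
      constructor
      · rintro ⟨h1, h2⟩
        refine ⟨h1, ?_⟩
        by_contra hno; simp only [not_or] at hno
        exact h2 ⟨⟨hno.1.1, fun t ht => (h1 t ht).1⟩, ⟨hno.1.2, fun t ht => (h1 t ht).2.1⟩, ⟨hno.2, fun t ht => (h1 t ht).2.2⟩⟩
      · rintro ⟨h1, hor⟩
        refine ⟨h1, fun h => ?_⟩
        rcases hor with (hxo | huo) | hvo
        · exact h.1.1 hxo
        · exact h.2.1.1 huo
        · exact h.2.2.1 hvo
    rw [← hdiff, measureReal_sdiff hsub (hmeas _), hR3, hQ3]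
  -- `V_i = R_i − N_i` (as `μ(D_i ∩ {v ∈ C_{S_i}})`)
  have hV1 : μ.real (D1 ∩ openConn x v) = R1 - N1 := by
    have hsub : {ω : BondConfig V | ∀ s ∈ ({x} : Set V), ∀ t ∈ insert v Y, ¬ (openGraph ω).Reachable s t} ⊆
        {ω : BondConfig V | ∀ s ∈ ({x} : Set V), ∀ t ∈ Y, ¬ (openGraph ω).Reachable s t} :=
      fun ω h s hs t ht => h s hs t (mem_insert_of_mem _ ht)
    have hdiff : {ω : BondConfig V | ∀ s ∈ ({x} : Set V), ∀ t ∈ Y, ¬ (openGraph ω).Reachable s t} \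
        {ω : BondConfig V | ∀ s ∈ ({x} : Set V), ∀ t ∈ insert v Y, ¬ (openGraph ω).Reachable s t} = D1 ∩ openConn x v := by
      ext ω
      simp only [mem_sdiff, mem_setOf_eq, mem_singleton_iff, forall_eq, mem_insert_iff, forall_eq_or_imp, mem_inter_iff, hD1, openConn]
      constructor
      · rintro ⟨h1, h2⟩; exact ⟨h1, by by_contra hxv; exact h2 ⟨hxv, h1⟩⟩
      · rintro ⟨h1, hxv⟩; exact ⟨h1, fun h => h.1 hxv⟩
    rw [← hdiff, measureReal_sdiff hsub (hmeas _), hR1, hN1]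
  -- the genuine gains as differences: `G_o = μ(D2 ∩ {o ∈ C_xu}) − μ(D2 ∩ {x↔o})`, `G_v` likewise
  have hGo : μ.real (D2 ∩ openConn u o ∩ (openConn x o)ᶜ) = μ.real (D2 ∩ (openConn x o ∪ openConn u o)) - μ.real (D2 ∩ openConn x o) := by
    have hsub : D2 ∩ openConn x o ⊆ D2 ∩ (openConn x o ∪ openConn u o) := inter_subset_inter_right _ subset_union_left
    have hset : (D2 ∩ (openConn x o ∪ openConn u o)) \ (D2 ∩ openConn x o) = D2 ∩ openConn u o ∩ (openConn x o)ᶜ := by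
      ext ω; simp only [mem_sdiff, mem_inter_iff, mem_union, mem_compl_iff]; tauto
    rw [← hset, measureReal_sdiff hsub (hmeas _)]
  have hGv : μ.real (D2 ∩ openConn u v ∩ (openConn x v)ᶜ) = μ.real (D2 ∩ (openConn x v ∪ openConn u v)) - μ.real (D2 ∩ openConn x v) := by
    have hsub : D2 ∩ openConn x v ⊆ D2 ∩ (openConn x v ∪ openConn u v) := inter_subset_inter_right _ subset_union_left
    have hset : (D2 ∩ (openConn x v ∪ openConn u v)) \ (D2 ∩ openConn x v) = D2 ∩ openConn u v ∩ (openConn x v)ᶜ := by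
      ext ω; simp only [mem_sdiff, mem_inter_iff, mem_union, mem_compl_iff]; tauto
    rw [← hset, measureReal_sdiff hsub (hmeas _)]
  have hV2 : μ.real (D2 ∩ (openConn x v ∪ openConn u v)) = R2 - N2 := by
    have hsub : {ω : BondConfig V | ∀ s ∈ ({x, u} : Set V), ∀ t ∈ insert v Y, ¬ (openGraph ω).Reachable s t} ⊆
        {ω : BondConfig V | ∀ s ∈ ({x, u} : Set V), ∀ t ∈ Y, ¬ (openGraph ω).Reachable s t} :=
      fun ω h s hs t ht => h s hs t (mem_insert_of_mem _ ht)
    have hdiff : {ω : BondConfig V | ∀ s ∈ ({x, u} : Set V), ∀ t ∈ Y, ¬ (openGraph ω).Reachable s t} \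
        {ω : BondConfig V | ∀ s ∈ ({x, u} : Set V), ∀ t ∈ insert v Y, ¬ (openGraph ω).Reachable s t} =
        D2 ∩ (openConn x v ∪ openConn u v) := by
      rw [eD2]; ext ω
      simp only [mem_sdiff, mem_setOf_eq, mem_insert_iff, mem_singleton_iff, forall_eq_or_imp, forall_eq, mem_inter_iff, hD2,
        mem_union, openConn]
      constructor
      · rintro ⟨h1, h2⟩
        refine ⟨h1, ?_⟩
        by_contra hno; rw [not_or] at hno
        exact h2 ⟨⟨hno.1, fun t ht => (h1 t ht).1⟩, ⟨hno.2, fun t ht => (h1 t ht).2⟩⟩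
      · rintro ⟨h1, hor⟩
        refine ⟨h1, fun h => ?_⟩
        rcases hor with hxv | huv
        · exact h.1.1 hxv
        · exact h.2.1 huv
    rw [← hdiff, measureReal_sdiff hsub (hmeas _), hR2, hN2]
  -- abbreviations for the two mixed terms `μ(D2 ∩ {x↔o})`, `μ(D2 ∩ {x↔v})`
  set P2o := μ.real (D2 ∩ openConn x o) with hP2o
  set P2v := μ.real (D2 ∩ openConn x v) with hP2v
  rw [eD1, eD2, eD3] at *
  rw [hGo, hGv, hO1, hO2, hO3, hV1, hV2, Matrix.det_fin_three]
  simp only [Matrix.of_apply, Matrix.cons_val', Matrix.cons_val_zero, Matrix.cons_val_one, Matrix.cons_val_two,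
    Matrix.empty_val', Matrix.cons_val_fin_one, Matrix.head_cons, Matrix.tail_cons, Matrix.head_fin_const, hN30]
  ring

/-- **COROLLARY — the chain rule in the marker-dominance regime.**  In the notation of the file header (`𝒜 = {v ↮ {x}∪Y}`, `W = {v ↔ o}`):
if `μ(𝒜)·(R₁G_v + E_v)·(O₃R₂ − O₂R₃) ≤ μ(𝒜)·N₂R₃R₁·G_o + N₂R₃·μ(𝒜∩W)·E_v` (the genuine chain-rule inequality with the between-world `o`-boost
replaced by its marker-dominance lower bound), then `μ(𝒜) · K(xu,Y) · Δ ≥ 0`; by `Consts.betweenWorld_markerDominance` (`μ(𝒜∩W)·E_v ≤ μ(𝒜)·E_o`).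
[cite: VandenbergHaggstromKahn2005, Thm. 1.3 (p. 6)] [cite: Gladkov2024, Thm. 3.2] -/
theorem chainRuleDet_nonneg_of_betweenWorld_regime (w : Sym2 V → unitInterval) (x u v o : V) (Y : Set V) (hxv : x ≠ v)
    (h : (prodBernoulli w).real {ω : BondConfig V | ∀ t ∈ insert x Y, ¬ (openGraph ω).Reachable v t} *
          ((𝕂[w](({x} : Set V), Y) * (prodBernoulli w).real ({ω : BondConfig V | ∀ y ∈ Y, ¬ (openGraph ω).Reachable x y ∧ ¬ (openGraph ω).Reachable u y} ∩ openConn u v ∩ (openConn x v)ᶜ) +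
              (𝕂[w](({x} : Set V), Y) * (prodBernoulli w).real ({ω : BondConfig V | ∀ y ∈ Y, ¬ (openGraph ω).Reachable x y ∧ ¬ (openGraph ω).Reachable u y} ∩ openConn x v) - 𝕂[w](({x, u} : Set V), Y) * (prodBernoulli w).real ({ω : BondConfig V | ∀ y ∈ Y, ¬ (openGraph ω).Reachable x y} ∩ openConn x v))) *
            ((prodBernoulli w).real ({ω : BondConfig V | ∀ y ∈ Y, ¬ (openGraph ω).Reachable x y ∧ ¬ (openGraph ω).Reachable u y ∧ ¬ (openGraph ω).Reachable v y} ∩ (openConn x o ∪ openConn u o ∪ openConn v o)) * 𝕂[w](({x, u} : Set V), Y) -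
              (prodBernoulli w).real ({ω : BondConfig V | ∀ y ∈ Y, ¬ (openGraph ω).Reachable x y ∧ ¬ (openGraph ω).Reachable u y} ∩ (openConn x o ∪ openConn u o)) * 𝕂[w](({x, u, v} : Set V), Y))) ≤
        (prodBernoulli w).real {ω : BondConfig V | ∀ t ∈ insert x Y, ¬ (openGraph ω).Reachable v t} *
            (𝕂[w](({x, u} : Set V), insert v Y) * 𝕂[w](({x, u, v} : Set V), Y) * (𝕂[w](({x} : Set V), Y) *
              (prodBernoulli w).real ({ω : BondConfig V | ∀ y ∈ Y, ¬ (openGraph ω).Reachable x y ∧ ¬ (openGraph ω).Reachable u y} ∩ openConn u o ∩ (openConn x o)ᶜ))) +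
          𝕂[w](({x, u} : Set V), insert v Y) * 𝕂[w](({x, u, v} : Set V), Y) *
            ((prodBernoulli w).real ({ω : BondConfig V | ∀ t ∈ insert x Y, ¬ (openGraph ω).Reachable v t} ∩ openConn v o) *
              (𝕂[w](({x} : Set V), Y) * (prodBernoulli w).real ({ω : BondConfig V | ∀ y ∈ Y, ¬ (openGraph ω).Reachable x y ∧ ¬ (openGraph ω).Reachable u y} ∩ openConn x v) - 𝕂[w](({x, u} : Set V), Y) * (prodBernoulli w).real ({ω : BondConfig V | ∀ y ∈ Y, ¬ (openGraph ω).Reachable x y} ∩ openConn x v)))) :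
    0 ≤ (prodBernoulli w).real {ω : BondConfig V | ∀ t ∈ insert x Y, ¬ (openGraph ω).Reachable v t} *
      (𝕂[w](({x, u} : Set V), Y) * Matrix.det !![
        𝕂[w](({x} : Set V), insert v Y), 𝕂[w](({x} : Set V), Y), 𝕂[w](({x} : Set V), insert o Y);
        𝕂[w](({x, u} : Set V), insert v Y), 𝕂[w](({x, u} : Set V), Y), 𝕂[w](({x, u} : Set V), insert o Y);
        𝕂[w](({x, u, v} : Set V), insert v Y), 𝕂[w](({x, u, v} : Set V), Y), 𝕂[w](({x, u, v} : Set V), insert o Y)]) := by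
  classical
  rw [chainRuleDet_mul_eq_genuine_betweenWorld]
  -- between-world marker dominance: `μ(𝒜∩W)·E_v ≤ μ(𝒜)·E_o`
  have bw := betweenWorld_markerDominance w x u v o Y hxv
  have hD2 : {ω : BondConfig V | ∀ y ∈ Y, ¬ (openGraph ω).Reachable x y} ∩ {ω | ∀ y ∈ Y, ¬ (openGraph ω).Reachable u y} =
      {ω : BondConfig V | ∀ y ∈ Y, ¬ (openGraph ω).Reachable x y ∧ ¬ (openGraph ω).Reachable u y} := by
    ext ω; simp only [mem_inter_iff, mem_setOf_eq]
    exact ⟨fun h y hy => ⟨h.1 y hy, h.2 y hy⟩, fun h => ⟨fun y hy => (h y hy).1, fun y hy => (h y hy).2⟩⟩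
  have hR1 : (prodBernoulli w).real {ω : BondConfig V | ∀ y ∈ Y, ¬ (openGraph ω).Reachable x y} = 𝕂[w](({x} : Set V), Y) := by
    congr 1; ext ω; simp
  have hR2 : (prodBernoulli w).real {ω : BondConfig V | ∀ y ∈ Y, ¬ (openGraph ω).Reachable x y ∧ ¬ (openGraph ω).Reachable u y} =
      𝕂[w](({x, u} : Set V), Y) := by
    congr 1; ext ω
    simp only [mem_setOf_eq, mem_insert_iff, mem_singleton_iff, forall_eq_or_imp, forall_eq]
    exact ⟨fun h => ⟨fun t ht => (h t ht).1, fun t ht => (h t ht).2⟩, fun h t ht => ⟨h.1 t ht, h.2 t ht⟩⟩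
  rw [hD2, hR1, hR2] at bw
  have hN2 : 0 ≤ 𝕂[w](({x, u} : Set V), insert v Y) * 𝕂[w](({x, u, v} : Set V), Y) := mul_nonneg measureReal_nonneg measureReal_nonneg
  have hA : 0 ≤ (prodBernoulli w).real {ω : BondConfig V | ∀ t ∈ insert x Y, ¬ (openGraph ω).Reachable v t} := measureReal_nonneg
  have key := mul_le_mul_of_nonneg_left bw hN2
  nlinarith [key, h, hA]

end Consts

end Summit.CriticalPhenomena.PercolationContinuityZ3.Theorems

end
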